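import Summits.Ventures.HodgeRepro2.T6N41PlaceInertMain
import Summits.Ventures.HodgeRepro2.T6N41PlaceToy

/-!
# T6N41PlaceInertToy — non-vacuity witnesses for the inert layer (README §10.5(ii)(c)/(d))

Over the toy placement datum `N41PlaceToy.toyPl` (one unramified place, one prime of norm `2`, `RepGL = ℂˣ × ℂˣ`
= the Satake pair itself, `ps = Prod.mk`): an inert datum whose `RepU = Unit` (one representation `π_v`), with
`JH 𝔓 a := Set.univ` for `a = −1` and `∅` otherwise (so `π_v ∈ JH(I(χ′/χ))` exactly at `χ′/χ = ε′`),
`BCrog 𝔓 ρ := (−1, −1)` (Rogawski's `i_G̃(ε̃′)`, Satake parameters `(−1, (−1)⁻¹)`), `twist (a, b) ξ := (aξ, bξ)`,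
`χHarris = ξV = γD = −1`, `ωt = 1`, `βTrivial = thetaLift = True` — on which the elementary / definitional /
compat fields are PROVED (not assumed) and BOTH inert displays hold: (c) `InertDatum Pl` is instantiable, (d) the
hypotheses of `satake_inert` and of `N41_placement_inert` are jointly satisfiable (with `split := fun _ => False`
and the split residual vacuous — the toy's prime is inert), and the conclusion at the toy's unramified place
is obtained by applying the theorem.  No display is closed by `trivial` / `simp` / `decide` / `exact ⟨⟩` on a
general datum — each proof uses the toy's specific data.

§8(d): uses an L-value-free non-vanishing device: NO.
-/

namespace Summit.Ventures.HodgeRepro2.T6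
namespace N41PlaceToy

/-- The toy inert datum over `toyPl`. -/
noncomputable def toyIn : InertDatum toyPl where
  inert := fun _ => True
  RepU := fun _ => Unit
  π := fun _ => ()
  JH := fun _ a => if a = -1 then Set.univ else ∅
  BCrog := fun _ _ => (-1, -1)
  twist := fun _ p ξ => (p.1 * ξ, p.2 * ξ)
  twist_ps := fun _ _ _ _ => rfl
  ps_inj := fun _ a b c d h => Or.inl ⟨congrArg Prod.fst h, congrArg Prod.snd h⟩
  χHarris := fun _ => -1
  ξV := fun _ => -1
  γD := fun _ => -1
  ωt := fun _ => 1
  βTrivial := fun _ => True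
  thetaLift := fun _ => True
  thetaLift_all := fun _ => trivial
  βTrivial_of := fun _ _ _ => trivial
  χHarris_eq := fun _ _ _ => rfl
  ξV_eq := fun _ _ _ => rfl
  γD_eq := fun _ _ _ => rfl
  ωt_eq := fun _ _ => rfl
  η₂_def := fun _ _ _ => by simp [toyPl]
  η₁_def := fun _ _ _ => by simp [toyPl]
  BCχ_eq := fun _ _ _ => by simp [toyPl]

/-- Harris II (2.2.5)(b) holds on the toy: `π_v ∈ JH 𝔓 (χ′/χ)` since `χHarris = −1` selects `Set.univ`. -/
theorem toy_Harris : Hyp.HarrisII2007_Prop2_2_5_b toyIn := by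
  intro 𝔓 _ _ _ _
  change () ∈ (if ((-1 : ℂˣ)) = -1 then (Set.univ : Set Unit) else ∅)
  rw [if_pos rfl]
  exact Set.mem_univ _

/-- Rogawski §11.4 holds on the toy: the only non-empty packet is `JH 𝔓 (−1)`, whose lift `(−1, −1)` is
`ps 𝔓 (−1) (−1)⁻¹`. -/
theorem toy_Rogawski : Hyp.Rogawski1990_Sec11_4_BC toyIn := by
  intro 𝔓 _ a _ ρ hρ
  by_cases ha : a = -1
  · subst ha
    simp [toyIn, toyPl]
  · change ρ ∈ (if a = -1 then (Set.univ : Set Unit) else ∅) at hρ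
    rw [if_neg ha] at hρ
    exact hρ.elim

/-- The Satake identity at the toy's (inert) prime, obtained from `satake_inert`. -/
theorem toy_satake_inert : ∀ 𝔓, toyIn.inert 𝔓 → toyPl.b 𝔓 ∉ toyDatum.S →
    (toyPl.α 𝔓 = toyPl.η₁ 𝔓 ∧ toyPl.β 𝔓 = toyPl.η₂ 𝔓) ∨ (toyPl.α 𝔓 = toyPl.η₂ 𝔓 ∧ toyPl.β 𝔓 = toyPl.η₁ 𝔓) :=
  N41Place.satake_inert toyIn toy_Harris toy_Rogawski

/-- **(d) for the inert layer:** the hypotheses of `N41_placement_inert` hold jointly on the toy (no split prime: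
`split := fun _ => False`, the residual is vacuous, the dichotomy is `Or.inl trivial`) and its conclusion is
obtained by applying the theorem. -/
theorem toy_placement_inert :
    ∀ v ∉ toyDatum.S, ∀ s : ℂ, toyDatum.Lv v s = toyDatum.g₁ v s * toyDatum.g₂ v s :=
  N41Place.N41_placement_inert toyDatum toyPl toyIn (fun _ => False) toy_LR7 toy_Bump toy_Harris toy_Rogawski
    (fun _ _ => Or.inl trivial) (fun _ h => h.elim)

/-- The conclusion at the toy's unramified place, non-vacuous. -/
theorem toy_placement_inert_at_unit (s : ℂ) :
    toyDatum.Lv () s = toyDatum.g₁ () s * toyDatum.g₂ () s :=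
  toy_placement_inert () (Finset.notMem_empty _) s

end N41PlaceToy
end Summit.Ventures.HodgeRepro2.T6
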